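import Summits.QuantumFields.YangMills.Theorems.BalabanUVNodesN12FlatChartDerivIterLin
import Summits.QuantumFields.YangMills.Theorems.UnitScaleTiltProp7AxialGauge
import Summits.QuantumFields.YangMills.Theorems.UnitScaleTiltProp7CombGaugeIter
import Summits.QuantumFields.YangMills.Theorems.UnitScaleTiltProp7CombGauge
import HarnessLib

/-!
# BalabanUVNodes ∕ N12 — [Balaban1985Variational] (16)–(18) p. 280 LINEARISED AT THE FLAT CONFIGURATION: EVERY TANGENT DIRECTION HAS A COMB-AXIAL REPRESENTATIVE MODULO `Lie (4)`,
# INVISIBLE TO THE DERIVATIVE OF THE FLAT LEVEL-`k` CHART — the linearised comb-axial slice is a LINEAR SUBSPACE meeting every fibre of `DΦ(0)`; hence `honto` on the slice from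
# `honto` for the chart («Using the transformations (16) with u satisfying (4) we fix the axial gauge conditions Ax_k(𝔅_k, U₀)», p. 280; (45)∕(47) p. 285)

Cell `pub-ymgap` (HUMAN RULINGS D-0062 ∕ D-0149), WIDTH SEAT `pub-ymgap-dag-n12-w3` g2 (node N12 = [B15]; key K1⁷ `stmt-QuantumFields-20542`, `--kind proof --supports … --as helper`;
count-neutral).  THEOREMS ONLY (0 `def`, 0 `instance`, 0 `sorry`); every input CONSUMED BY NAME, nothing modified: the route UnitScaleTilt's comb axial gauge
`Prop7AxialGauge.exists_axialGauge` (EXISTENCE of the (4)-element, [Balaban1985RegularSpaces] (1.19)), its torus transport `B10Eq27TorusAxialLog.holT` ∕ `axialT` ∕ `gaugeActT` ∕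
`holT_one`, `Prop7CombGauge.iterLin_add`, `Prop7AvgLinearisation.iterLin_grad`; dag-n10-w1's `N12FlatChartDerivIterLin.fderiv_msChart_one_apply_eq_iterLin`; the signed walk sums
`BlockAveragingEMLLinearised.walkSum` over `T4Continuum.walk`.  Companion of this seat's `BalabanUVNodesN12FlatCombAxialHnd` (the TRANSVERSALITY half: the slice meets `Lie (4)` only in
`0`); this file is the SPANNING half (slice + `Lie (4)` = everything) and the dictionary making the slice an honest linear subspace.

THE DEVICE (as in the companion).  The linearised comb-axial condition on an additive-group valued bond field `X` — the signed sum of `X` along the comb `Γ_{y(x),x}` from the centre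
`y(x)` of the `k`-block of `x` vanishes — is the comb-axial gauge condition of `Prop7AxialGauge` in the commutative gauge group `Multiplicative V` (§1 makes this an `iff` with the
signed `walkSum`); an infinitesimal gauge transformation `X ↦ X − dψ` is the gauge action of `ofAdd ∘ ψ`.

CONTENTS.
§1 `toAdd_holT_ofAdd` (torus transport of `ofAdd ∘ X` along a word = `ofAdd` of the signed walk sum: the two walk machineries of the tree spell words identically), ★ `axialT_ofAdd_eq_one_iff`
   (comb-axial ⟺ signed comb sum `= 0`); linearity by the tree's `Prop7CombGauge.walkSum_add` ∕ `Prop8Chart.walkSum_const_smul`.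
§2 the slice is LINEAR: `combAxial_zero`, `combAxial_add`, `combAxial_smul` (any ring of scalars acting on `V` — in particular `ℝ` on `𝔰𝔲(N)` and `ℂ` after complexification).
§3 ★★ `exists_centreGauge_sub_grad_combAxial` — for `k ≤ m + K` every `X` has a `ψ` vanishing at the `k`-fold centres with `X − dψ` comb-axial ([15] (16)–(18), linearised; the
   (4)-element of `exists_axialGauge` read additively).
§4 at NODE 00's flat multi-scale chart `Φ = msChart F N K k 𝔹 (M˙1) 1` with LEVEL-`k` CONSTRAINTS ONLY (`𝔹 j = ∅` for `j ≠ k`): `fderiv_msChart_one_sub_centreGrad` (`DΦ(0)(X − dψ) = DΦ(0)X` for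
   centre-vanishing `ψ`), ★★ `exists_combAxial_fderiv_msChart_one_eq` (a comb-axial `X′ = X − dψ` with `DΦ(0)X′ = DΦ(0)X`), ★★ `exists_combAxial_fderiv_msChart_one_eq_of_surjective` (`honto` on
   the slice from `honto` for `Φ` — n07-w2's `IsFibreChartNear` range clause).

HONEST FRAMING.  Flat configuration only (`U₀ = 1`); LEVEL-`k` constraints only in §4 (with lower-level constraints the group must be cut down to transformations trivial at those centres
too — not done here); complete COMB axial gauge (the route UnitScaleTilt's reading of [15] (18)); `honto` for `Φ` itself stays n07-w2's ∕ the N07 lane's letter (displayed in §4's last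
theorem); nothing quantitative ((1.25)-type sup bounds of the representative are NOT here).  Nothing of Bałaban's estimates is asserted; N12 NOT discharged; K1⁷ NOT closed; counts unmoved
(typed 28∕28 · discharged 5∕27); one finite 𝕋⁴ programme at fixed ε — R4 closes the conditional rung `BalabanLadder.UV` only; the Yang–Mills mass gap (Clay) is NOT proved by any of this;
nothing continuum ∕ ℝ⁴ ∕ OS.
-/

noncomputable section

namespace Summit.QuantumFields.YangMills.BalabanUVNodes.N12FlatCombAxialRepr

open scoped BigOperators Matrix.Norms.L2Operator Topology
open Literature.MathematicalPhysics.QuantumFieldTheory.Balaban1983to89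
open T4Continuum (T4Family walk LStep)
open BlockAveragingEMLLinearised (linAvg walkSum walkSum_cons walkSum_nil)
open T4AdjointCovarianceUnitary (lieSU)
open B15DeterminingSets
open B5Eq118OneStroke (iterBlockOf)
open B10Eq27TorusAxialLog (axialT gaugeActT holT rel)
open B7Prop1Explicit (treeWord)
open Node00
open Summit.QuantumFields.YangMills.Theorems.Prop7AxialGauge (exists_axialGauge axialT_gaugeActT)
open Summit.QuantumFields.YangMills.Theorems.Prop7CombGauge (iterLin_add walkSum_add)
open Summit.QuantumFields.YangMills.Theorems.Prop8Chart (walkSum_const_smul)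
open Summit.QuantumFields.YangMills.Theorems.Prop7AvgLinearisation (iterLin_grad)
open Summit.QuantumFields.YangMills.BalabanUVNodes.N12FlatChartDerivIterLin (fderiv_msChart_one_apply_eq_iterLin)

/-! ## §1 The dictionary: comb holonomy in `Multiplicative V` is the signed comb sum -/

section Dictionary

variable {P : Params} {j : ℕ} {V : Type*} [AddCommGroup V]

/-- **Torus transport of an additive field read multiplicatively is the signed walk sum**: `toAdd (holT (ofAdd ∘ X) x w) = Σ_{b ⊂ walk x w} ±X_b` (same steps, same
orientations: `B10Eq27TorusAxialLog.holT` and `T4Continuum.walk` spell the word identically). [cite: Balaban1985Averaging, (9) p.18; Balaban1984PropagatorsI, (1.8) p.19] -/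
theorem toAdd_holT_ofAdd (X : PBond P j → V) :
    ∀ (x : Site P j) (w : List (B7Prop1Explicit.Letter P.d)),
      Multiplicative.toAdd (holT (fun b : PBond P j => Multiplicative.ofAdd (X b)) x w) = walkSum X (walk x w)
  | x, [] => by simp [walk]
  | x, (μ, true) :: w => by
    rw [B10Eq27TorusAxialLog.holT_cons_true, toAdd_mul, toAdd_ofAdd, toAdd_holT_ofAdd X (x.shift μ) w]
    simp [walk, walkSum_cons]
  | x, (μ, false) :: w => by
    rw [B10Eq27TorusAxialLog.holT_cons_false, toAdd_mul, toAdd_inv, toAdd_ofAdd, toAdd_holT_ofAdd X (x.unshift μ) w]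
    simp [walk, walkSum_cons]

/-- **THE LINEARISED COMB-AXIAL CONDITION, ADDITIVELY**: the comb holonomy of `ofAdd ∘ X` from `y` to `x` is `1` IFF the signed sum of `X` along the comb `Γ_{y,x}` (the word
`treeWord (rel y x)` walked from `y`) vanishes. [cite: Balaban1985Variational, (18) p.280; Balaban1984PropagatorsI, (1.10) p.19] -/
theorem axialT_ofAdd_eq_one_iff (X : PBond P j → V) (y x : Site P j) :
    axialT (fun b : PBond P j => Multiplicative.ofAdd (X b)) y x = 1 ↔ walkSum X (walk y (treeWord (rel y x))) = 0 := by
  rw [← toAdd_holT_ofAdd X y, axialT]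
  exact ⟨fun h => by rw [h, toAdd_one], fun h => by rw [← ofAdd_toAdd (holT _ y _), h, ofAdd_zero]⟩

end Dictionary

/-! ## §2 The linearised comb-axial slice is a linear subspace -/

section Linear

variable {P : Params} {k : ℕ} {V : Type*} [AddCommGroup V]

/-- `0` is comb-axial. [cite: Balaban1985Variational, (18) p.280 (bookkeeping)] -/
theorem combAxial_zero (x : Site P 0) :
    axialT (fun _ : PBond P 0 => Multiplicative.ofAdd (0 : V)) (embIter k (iterBlockOf k x)) x = 1 :=
  B10Eq27TorusAxialLog.holT_one _ _

/-- Sums of comb-axial fields are comb-axial. [cite: Balaban1985Variational, (18) p.280 (bookkeeping)] -/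
theorem combAxial_add {X Y : PBond P 0 → V}
    (hX : ∀ x : Site P 0, axialT (fun b : PBond P 0 => Multiplicative.ofAdd (X b)) (embIter k (iterBlockOf k x)) x = 1)
    (hY : ∀ x : Site P 0, axialT (fun b : PBond P 0 => Multiplicative.ofAdd (Y b)) (embIter k (iterBlockOf k x)) x = 1) (x : Site P 0) :
    axialT (fun b : PBond P 0 => Multiplicative.ofAdd (X b + Y b)) (embIter k (iterBlockOf k x)) x = 1 := by
  refine (axialT_ofAdd_eq_one_iff (fun b => X b + Y b) _ _).2 ?_
  rw [walkSum_add, (axialT_ofAdd_eq_one_iff X _ _).1 (hX x), (axialT_ofAdd_eq_one_iff Y _ _).1 (hY x), add_zero]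

/-- Scalar multiples of comb-axial fields are comb-axial. [cite: Balaban1985Variational, (18) p.280 (bookkeeping)] -/
theorem combAxial_smul {R : Type*} [Monoid R] [DistribMulAction R V] (r : R) {X : PBond P 0 → V}
    (hX : ∀ x : Site P 0, axialT (fun b : PBond P 0 => Multiplicative.ofAdd (X b)) (embIter k (iterBlockOf k x)) x = 1) (x : Site P 0) :
    axialT (fun b : PBond P 0 => Multiplicative.ofAdd (r • X b)) (embIter k (iterBlockOf k x)) x = 1 := by
  refine (axialT_ofAdd_eq_one_iff (fun b => r • X b) _ _).2 ?_
  rw [walkSum_const_smul, (axialT_ofAdd_eq_one_iff X _ _).1 (hX x), smul_zero]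

end Linear

/-! ## §3 Comb-axial representatives inside `Lie (4)`: existence -/

section Repr

variable {P : Params} {k : ℕ} {V : Type*} [AddCommGroup V]

/-- ★★ **EVERY FINE FIELD HAS A COMB-AXIAL REPRESENTATIVE MODULO A CENTRE-VANISHING PURE GAUGE** ([Balaban1985Variational] p. 280 «Using the transformations (16) with u satisfying (4) we fix
the axial gauge conditions», linearised): for `k ≤ m + K` and every `X` there is `ψ` with `ψ = 0` at the `k`-fold centres such that `X − dψ` is comb-axial — the route UnitScaleTilt's
`Prop7AxialGauge.exists_axialGauge` in the commutative gauge group `Multiplicative V` (background `1`, configuration `ofAdd ∘ X`, `ψ = toAdd ∘ v`).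
[cite: Balaban1985Variational, (16)-(18) p.280, (4) p.278; Balaban1985RegularSpaces, (1.19) p.79] -/
theorem exists_centreGauge_sub_grad_combAxial (hk : k ≤ P.m + P.K) (X : PBond P 0 → V) :
    ∃ ψ : Site P 0 → V, (∀ y : Site P k, ψ (embIter k y) = 0) ∧
      ∀ x : Site P 0, axialT (fun b : PBond P 0 => Multiplicative.ofAdd (X b - (ψ b.tgt - ψ b.src))) (embIter k (iterBlockOf k x)) x = 1 := by
  obtain ⟨v, hv, hax⟩ := exists_axialGauge (G := Multiplicative V) hk (fun _ : PBond P 0 => (1 : Multiplicative V))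
    (fun b : PBond P 0 => Multiplicative.ofAdd (X b))
  refine ⟨fun x => Multiplicative.toAdd (v x), fun y => ?_, fun x => ?_⟩
  · show Multiplicative.toAdd (v (embIter k y)) = 0
    rw [hv y, toAdd_one]
  have hgauge : gaugeActT v (fun b : PBond P 0 => Multiplicative.ofAdd (X b)) =
      fun b : PBond P 0 => Multiplicative.ofAdd (X b - (Multiplicative.toAdd (v b.tgt) - Multiplicative.toAdd (v b.src))) := by
    funext b
    rw [B10Eq27TorusAxialLog.gaugeActT_apply]
    apply Multiplicative.toAdd.injective
    rw [toAdd_mul, toAdd_mul, toAdd_inv, toAdd_ofAdd, toAdd_ofAdd]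
    abel
  rw [← hgauge, hax x]
  exact B10Eq27TorusAxialLog.holT_one _ _

end Repr

/-! ## §4 At NODE 00's flat multi-scale chart with level-`k` constraints only: comb-axial representatives of the linearised data, and `honto` on the slice -/

section NodeZero

variable {F : T4Family} {N : ℕ} [NeZero N] {K k : ℕ}

/-- **A centre-vanishing pure gauge is invisible to the derivative of the flat level-`k` chart**: if `𝔹` constrains level-`k` bonds only and `ψ` vanishes at the `k`-fold centres, then
`DΦ(0)(X − dψ) = DΦ(0)X` for `Φ = msChart F N K k 𝔹 (M˙1) 1` (`(DΦ(0)dψ)_{(k,c)} = π(ψ(embIter k c₊) − ψ(embIter k c₋)) = 0`). [cite: Balaban1985Variational, (4) p.278, (45) p.285; Balaban1985Averaging, (11) p.18] -/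
theorem fderiv_msChart_one_sub_centreGrad (𝔹 : DetSet (F.P K)) (h𝔹 : ∀ j, j ≠ k → 𝔹 j = ∅)
    (X : PBond (F.P K) 0 → lieSU (Fin N)) {ψ : Site (F.P K) 0 → lieSU (Fin N)} (hψ : ∀ y : Site (F.P K) k, ψ (embIter k y) = 0) :
    fderiv ℝ (msChart F N K k 𝔹 (avgFamily (avOfRecord F N K) (1 : GaugeField (F.P K) 0 (SU N))) (1 : GaugeField (F.P K) 0 (SU N))) 0
        (fun b => X b - (ψ b.tgt - ψ b.src)) =
      fderiv ℝ (msChart F N K k 𝔹 (avgFamily (avOfRecord F N K) (1 : GaugeField (F.P K) 0 (SU N))) (1 : GaugeField (F.P K) 0 (SU N))) 0 X := by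
  obtain ⟨Q, hQ0, hQs⟩ : ∃ Q : (i : ℕ) → (PBond (F.P K) 0 → Matrix (Fin N) (Fin N) ℂ) → PBond (F.P K) i → Matrix (Fin N) (Fin N) ℂ,
      (∀ Y, Q 0 Y = Y) ∧ ∀ (i : ℕ) (Y : PBond (F.P K) 0 → Matrix (Fin N) (Fin N) ℂ) (c : PBond (F.P K) (i + 1)), Q (i + 1) Y c = linAvg (Q i Y) c :=
    ⟨fun i => Nat.rec (motive := fun i => (PBond (F.P K) 0 → Matrix (Fin N) (Fin N) ℂ) → PBond (F.P K) i → Matrix (Fin N) (Fin N) ℂ) (fun Y => Y)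
      (fun _ Qi Y c => linAvg (Qi Y) c) i, fun _ => rfl, fun _ _ _ => rfl⟩
  funext i
  rw [fderiv_msChart_one_apply_eq_iterLin Q hQ0 hQs 𝔹 _ i, fderiv_msChart_one_apply_eq_iterLin Q hQ0 hQs 𝔹 X i]
  -- the constrained bond `i` is at level `k`
  rcases hs : (constrEnum 𝔹 k).symm i with ⟨⟨j, hjlt⟩, c, hc⟩
  have key : ∀ (j : ℕ) (c : PBond (F.P K) j), j ≠ k → c ∉ bondsOf (𝔹 j) := fun j c hne => by
    rw [h𝔹 j hne]
    simp [bondsOf]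
  obtain rfl : j = k := by
    by_contra hne
    exact key _ _ hne hc
  -- split `X − dψ = X + d(−ψ)` and kill the pure gauge at level `k`
  have hsplit : (fun b : PBond (F.P K) 0 => ((X b - (ψ b.tgt - ψ b.src) : lieSU (Fin N)) : Matrix (Fin N) (Fin N) ℂ)) =
      fun b => (X b : Matrix (Fin N) (Fin N) ℂ) + ((fun x => -(ψ x : Matrix (Fin N) (Fin N) ℂ)) b.tgt - (fun x => -(ψ x : Matrix (Fin N) (Fin N) ℂ)) b.src) := by
    funext b
    simp only [Submodule.coe_sub]
    abel
  have hg := iterLin_grad Q hQ0 hQs (fun i φ y => φ (embIter i y)) (fun φ => rfl) (fun i φ y => rfl)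
    (fun x => -(ψ x : Matrix (Fin N) (Fin N) ℂ)) j c
  simp only
  congr 1
  rw [hsplit, iterLin_add Q hQ0 hQs, hg]
  simp only [hψ, ZeroMemClass.coe_zero, neg_zero, sub_self, add_zero]

/-- ★★ **COMB-AXIAL REPRESENTATIVES OF THE LINEARISED DATA**: with level-`k` constraints only and `k ≤ m + K`, for every direction `X` there is a COMB-AXIAL `X′ = X − dψ` (`ψ` vanishing at the
`k`-fold centres, `𝔰𝔲(N)`-valued) with the same image under `DΦ(0)` — [Balaban1985Variational] (18) at the linearised level: the group (4) moves every tangent vector into the axial slice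
without changing the linearised constraint. [cite: Balaban1985Variational, (16)-(18) p.280, (45) p.285] -/
theorem exists_combAxial_fderiv_msChart_one_eq (hk : k ≤ (F.P K).m + (F.P K).K) (𝔹 : DetSet (F.P K)) (h𝔹 : ∀ j, j ≠ k → 𝔹 j = ∅)
    (X : PBond (F.P K) 0 → lieSU (Fin N)) :
    ∃ X' : PBond (F.P K) 0 → lieSU (Fin N),
      (∀ x : Site (F.P K) 0, axialT (fun b : PBond (F.P K) 0 => Multiplicative.ofAdd (X' b)) (embIter k (iterBlockOf k x)) x = 1) ∧
      (∃ ψ : Site (F.P K) 0 → lieSU (Fin N), (∀ y : Site (F.P K) k, ψ (embIter k y) = 0) ∧ ∀ b, X' b = X b - (ψ b.tgt - ψ b.src)) ∧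
      fderiv ℝ (msChart F N K k 𝔹 (avgFamily (avOfRecord F N K) (1 : GaugeField (F.P K) 0 (SU N))) (1 : GaugeField (F.P K) 0 (SU N))) 0 X' =
        fderiv ℝ (msChart F N K k 𝔹 (avgFamily (avOfRecord F N K) (1 : GaugeField (F.P K) 0 (SU N))) (1 : GaugeField (F.P K) 0 (SU N))) 0 X := by
  obtain ⟨ψ, hψ, hax⟩ := exists_centreGauge_sub_grad_combAxial hk X
  exact ⟨fun b => X b - (ψ b.tgt - ψ b.src), hax, ⟨ψ, hψ, fun b => rfl⟩, fderiv_msChart_one_sub_centreGrad 𝔹 h𝔹 X hψ⟩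

/-- ★★ **`honto` ON THE COMB-AXIAL SLICE FROM `honto` FOR THE CHART** ([15] (45)∕(47) restricted to the axial subspace): with level-`k` constraints only, if the derivative at `0` of the flat
multi-scale chart is onto (n07-w2's `IsFibreChartNear` range clause), then so is its restriction to the linearised comb-axial slice — every linearised datum is realised by a comb-axial
direction. [cite: Balaban1985Variational, (18) p.280, (45)-(47) p.285] -/
theorem exists_combAxial_fderiv_msChart_one_eq_of_surjective (hk : k ≤ (F.P K).m + (F.P K).K) (𝔹 : DetSet (F.P K)) (h𝔹 : ∀ j, j ≠ k → 𝔹 j = ∅)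
    (hont : Function.Surjective
      (fderiv ℝ (msChart F N K k 𝔹 (avgFamily (avOfRecord F N K) (1 : GaugeField (F.P K) 0 (SU N))) (1 : GaugeField (F.P K) 0 (SU N))) 0))
    (y : Fin (constrCard 𝔹 k) → lieSU (Fin N)) :
    ∃ X' : PBond (F.P K) 0 → lieSU (Fin N),
      (∀ x : Site (F.P K) 0, axialT (fun b : PBond (F.P K) 0 => Multiplicative.ofAdd (X' b)) (embIter k (iterBlockOf k x)) x = 1) ∧
      fderiv ℝ (msChart F N K k 𝔹 (avgFamily (avOfRecord F N K) (1 : GaugeField (F.P K) 0 (SU N))) (1 : GaugeField (F.P K) 0 (SU N))) 0 X' = y := by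
  obtain ⟨X, hX⟩ := hont y
  obtain ⟨X', hax, -, hD⟩ := exists_combAxial_fderiv_msChart_one_eq hk 𝔹 h𝔹 X
  exact ⟨X', hax, hD.trans hX⟩

end NodeZero

end Summit.QuantumFields.YangMills.BalabanUVNodes.N12FlatCombAxialRepr

end
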